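import Mathlib
import HarnessLib
import Summits.ResolutionOfSingularities.ResolutionOfSingularities.Theorems.HomologicalConductorPersistenceMonomialCusp
import Summits.ResolutionOfSingularities.ResolutionOfSingularities.Theorems.HomologicalConductorPersistencePeriodicSaturation
import Summits.ResolutionOfSingularities.ResolutionOfSingularities.Theorems.HomologicalConductorPersistenceConductorCeilingRingHom

/-!
# The cohomology annihilator of a MONOMIAL PLANE CURVE BRANCH is its conductor — EXACTLY, at every level:
# `r ∈ ca(k[t][z]/(zᵐ − εᵐtⁿ)) ↔ τ^{(m−1)(n−1)} ∣ r(ετⁿ, τᵐ)`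

Route `ResolutionOfSingularities/HomologicalConductor`, chain W4.4b, rung S-2 `PersistenceSurface`
(stmt-ResolutionOfSingularities-19970): the curve side of the cA-arena enabling formula
(`…PersistenceArenaSandwich`: `ca(k[x,y,z,t]/(xy − h)) = (x,y) + ι(ca(k[z,t]/(h)))`) and of the one-square rule for the
suspension census (class S-a: `A_{2j}`, `E₆ = (3,4)`, `E₈ = (3,5)`, `E₁₂ = (3,7)`, `W₁₂ = (4,5)`, …); seat res-L1-w44b-stub-2
(gen 5).  [OURS · L1 w44b; AI-written, weaker than expert review; NOT a statement of the manuscript under study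
(Hironaka 2017), and no statement of that manuscript is used.]

For a field `k`, `ε ≠ 0` and coprime `m, n > 1` let `R = k[t][z]/(zᵐ − εᵐ tⁿ)`, realised as `AdjoinRoot f`,
`f = Xᵐ − C(C εᵐ · tⁿ) ∈ k[t][X]` (a power basis over `k[t]`), with the parametrisation `φ : R → k[τ]`, `t ↦ τᵐ`,
`z ↦ ε τⁿ` (`AdjoinRoot.lift` of `expand m`), and `c = (m−1)(n−1)` the conductor of the semigroup `⟨m, n⟩`.  Then:

* `lift_injective` — `φ` is injective (normal form by the power basis + the coefficient separation
  `MonomialCusp.coeff_sum_expand`, p542769); hence `R` is a domain (`isDomain_adjoinRoot`);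
* `coeff_lift_eq_zero` — the image of `φ` is supported on the semigroup: `(φ r).coeff N = 0` unless `N = ma + nb`;
* `exists_lift_eq_X_pow_mul` — `τᶜ·k[τ] ⊆ φ(R)` (`MonomialCusp.exists_param_eq_X_pow_mul` pushed through `R`);
* `forall_exists_iff_X_pow_dvd` — **the conductor of `R` in `k[τ]` is `{r | τᶜ ∣ φ r}`** (`⇐` image lemma; `⇒`: a
  coefficient of `φ r` below `c`, in degree `d`, would put the gap `τ^{c−1} = τ^{mn−m−n}` into the support of
  `φ(r)·τ^{c−1−d} ∈ φ(R)`, contradicting Sylvester/Mathlib `frobeniusNumber_pair`);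
* `finite_polynomial` (`k[τ] = Σ_{j<m} φ(R)·τʲ`) and SATURATION `ca(R) = ca²(R)` (`k[t]` regular of dimension `1`,
  `…PersistencePeriodicSaturation.cohomologyAnnihilator_adjoinRoot_eq_of_isRegularRing`);
* **`mem_cohomologyAnnihilator_iff_X_pow_dvd`** — `r ∈ ca(R) ↔ τᶜ ∣ φ r`, and `mem_cohomologyAnnihilatorOfDegree_iff_X_pow_dvd`
  — the same for every `caᴺ(R)`, `N ≥ 2` (`⇐`: the PID conductor floor `…ConductorStable`, p532769; `⇒`: saturation + the
  ring-map ceiling `…ConductorCeilingRingHom`, p560485, with `c₀ = t̄^{n−1}`);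
* **`root_pow_mul_of_X_pow_mem_cohomologyAnnihilator_iff`** — MONOMIALS: `z̄ᵇ·t̄ᵃ ∈ ca(R) ↔ (m−1)(n−1) ≤ nb + ma`.
  E.g. `E₆ = (3,4)`, `c = 6`: `z̄, t̄ ∉ ca(R)` at EVERY level, `z̄², z̄t̄, t̄² ∈ ca(R)`; every field, fact-free (the `⊆`
  half for monomials is `MonomialCusp.mk_monomial_mem_cohomologyAnnihilatorOfDegree_two`, p542769, in the `k[z,t]/(h)`
  presentation).

This is the content of «the cohomology annihilator of a curve is its conductor» ([Esentepe2020, Thm 4.4], reduced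
complete Gorenstein curves) on the monomial branches, with no appeal to that fact; the tree's named fact
`planeCurve_cohomologyAnnihilator_eq_conductor` (all reduced `h ∈ k⟦z,t⟧`) is NOT discharged.

References (mechanism only): S. B. Iyengar, R. Takahashi, IMRN 2016 §2 [`IyengarTakahashi2014`]; Ö. Esentepe,
J. Algebra 541 (2020), arXiv:1807.05471, Thm 4.4 [`Esentepe2020`] (statement shape only); J. J. Sylvester 1882
(Mathlib `frobeniusNumber_pair`).
-/

noncomputable section

-- single-problem summit: the doubled namespace component `ResolutionOfSingularities` is forced
set_option linter.dupNamespace false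

namespace Summit.ResolutionOfSingularities.ResolutionOfSingularities.Theorems.HomologicalConductor.MonomialCurveExact

open Polynomial Literature.RingTheory.CohomologyAnnihilator
open Summit.ResolutionOfSingularities.ResolutionOfSingularities.Theorems.HomologicalConductor.MonomialCusp
  (coeff_sum_expand exists_param_eq_X_pow_mul param_X_zero param_X_one)
open Summit.ResolutionOfSingularities.ResolutionOfSingularities.Theorems.HomologicalConductor.ConductorStable
  (mem_cohomologyAnnihilatorOfDegree_two_of_conductor_ringHom)
open Summit.ResolutionOfSingularities.ResolutionOfSingularities.Theorems.HomologicalConductor.PeriodicSaturation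
  (cohomologyAnnihilator_adjoinRoot_eq_of_isRegularRing)
open Summit.ResolutionOfSingularities.ResolutionOfSingularities.Theorems.HomologicalConductor.ConductorCeilingRingHom
  (exists_eq_mul_of_mem_cohomologyAnnihilatorOfDegree_three)

universe u

variable (k : Type u) [Field k] (ε : k) (m n : ℕ)

/-! ## §1 The curve `R = k[t][z]/(zᵐ − εᵐtⁿ)` as `AdjoinRoot` and its parametrisation -/

/-- `f = Xᵐ − C(C εᵐ · tⁿ)` is monic for `m > 0`. [folklore] -/
theorem monic_f (hm : 0 < m) : (X ^ m - C (C (ε ^ m) * X ^ n) : Polynomial (Polynomial k)).Monic :=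
  Polynomial.monic_X_pow_sub_C _ (Nat.pos_iff_ne_zero.mp hm)

/-- `f(ετⁿ) = 0` along `t ↦ τᵐ`: `(ετⁿ)ᵐ = εᵐ (τᵐ)ⁿ`. [folklore] -/
theorem eval₂_f_eq_zero :
    (X ^ m - C (C (ε ^ m) * X ^ n) : Polynomial (Polynomial k)).eval₂ ((Polynomial.expand k m : Polynomial k →ₐ[k] Polynomial k) : Polynomial k →+* Polynomial k)
      (C ε * X ^ n) = 0 := by
  rw [eval₂_sub, eval₂_pow, eval₂_X, eval₂_C, RingHom.coe_coe, map_mul (Polynomial.expand k m : _ →ₐ[k] _),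
    Polynomial.expand_C, map_pow (Polynomial.expand k m : _ →ₐ[k] _), Polynomial.expand_X, mul_pow, ← C_pow,
    ← pow_mul, ← pow_mul, mul_comm n m, sub_self]

/-- `φ(z̄) = ε τⁿ`. [folklore] -/
theorem lift_root : AdjoinRoot.lift ((Polynomial.expand k m : Polynomial k →ₐ[k] Polynomial k) : Polynomial k →+* Polynomial k)
        (C ε * X ^ n) (eval₂_f_eq_zero k ε m n) (AdjoinRoot.root _) = C ε * X ^ n :=
  AdjoinRoot.lift_root _

/-- `φ(p(t)) = p(τᵐ)`. [folklore] -/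
theorem lift_of (p : Polynomial k) : AdjoinRoot.lift ((Polynomial.expand k m : Polynomial k →ₐ[k] Polynomial k) : Polynomial k →+* Polynomial k)
        (C ε * X ^ n) (eval₂_f_eq_zero k ε m n) (AdjoinRoot.of _ p) = Polynomial.expand k m p := by
  rw [AdjoinRoot.lift_of, RingHom.coe_coe]

/-- `φ(t̄ʲ) = τ^{mj}`. [folklore] -/
theorem lift_of_X_pow (j : ℕ) : AdjoinRoot.lift ((Polynomial.expand k m : Polynomial k →ₐ[k] Polynomial k) : Polynomial k →+* Polynomial k)
        (C ε * X ^ n) (eval₂_f_eq_zero k ε m n) (AdjoinRoot.of _ (X ^ j)) = X ^ (m * j) := by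
  rw [lift_of, map_pow, Polynomial.expand_X, ← pow_mul]

/-- `φ` on a class `mk g`: `Σⱼ expandₘ(gⱼ) (ετⁿ)ʲ`. [folklore] -/
theorem lift_mk (g : Polynomial (Polynomial k)) :
    AdjoinRoot.lift ((Polynomial.expand k m : Polynomial k →ₐ[k] Polynomial k) : Polynomial k →+* Polynomial k)
        (C ε * X ^ n) (eval₂_f_eq_zero k ε m n) (AdjoinRoot.mk _ g) = g.sum (fun j a => Polynomial.expand k m a * (C ε * X ^ n) ^ j) := by
  rw [AdjoinRoot.lift_mk, Polynomial.eval₂_eq_sum]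
  rfl

/-- The `k[z,t]`-parametrisation `θ` of `…PersistenceMonomialCusp` factors through `φ`: `φ(g(z̄, t̄)) = θ(g)`. [folklore] -/
theorem lift_aeval (g : MvPolynomial (Fin 2) k) :
    AdjoinRoot.lift ((Polynomial.expand k m : Polynomial k →ₐ[k] Polynomial k) : Polynomial k →+* Polynomial k)
        (C ε * X ^ n) (eval₂_f_eq_zero k ε m n) (MvPolynomial.aeval (R := k) (![AdjoinRoot.root (X ^ m - C (C (ε ^ m) * X ^ n) : Polynomial (Polynomial k)), AdjoinRoot.of (X ^ m - C (C (ε ^ m) * X ^ n) : Polynomial (Polynomial k)) X] : Fin 2 → AdjoinRoot (X ^ m - C (C (ε ^ m) * X ^ n) : Polynomial (Polynomial k))) g) =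
      MvPolynomial.aeval (R := k) (![C ε * X ^ n, X ^ m] : Fin 2 → Polynomial k) g := by
  induction g using MvPolynomial.induction_on with
  | C a =>
    rw [MvPolynomial.algHom_C, MvPolynomial.algHom_C, Polynomial.algebraMap_eq,
      IsScalarTower.algebraMap_apply k (Polynomial k) (AdjoinRoot (X ^ m - C (C (ε ^ m) * X ^ n) : Polynomial (Polynomial k))), AdjoinRoot.algebraMap_eq, lift_of,
      Polynomial.algebraMap_eq, Polynomial.expand_C]
  | add p q hp hq => simp only [map_add, hp, hq]
  | mul_X p i hp =>
    simp only [map_mul, hp, MvPolynomial.aeval_X]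
    congr 1
    fin_cases i
    · exact lift_root k ε m n
    · simp [Polynomial.expand_X]

/-! ## §2 Injectivity of `φ` (so `R` is a domain) -/

/-- **`φ` is injective** (`ε ≠ 0`, `m, n` coprime, `m > 0`): reduce modulo the monic `f` to degree `< m` and separate
the coefficients of `Σ_{j<m} expandₘ(gⱼ) εʲ τ^{nj}` (`MonomialCusp.coeff_sum_expand`). [folklore] -/
theorem lift_injective (hε : ε ≠ 0) (hmn : Nat.Coprime m n) (hm : 0 < m) : Function.Injective (AdjoinRoot.lift ((Polynomial.expand k m : Polynomial k →ₐ[k] Polynomial k) : Polynomial k →+* Polynomial k)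
        (C ε * X ^ n) (eval₂_f_eq_zero k ε m n)) := by
  rw [injective_iff_map_eq_zero]
  intro r hr
  obtain ⟨g, rfl⟩ := AdjoinRoot.mk_surjective r
  have hfm : (X ^ m - C (C (ε ^ m) * X ^ n) : Polynomial (Polynomial k)).Monic := monic_f k ε m n hm
  -- replace `g` by its remainder `g %ₘ f`, of degree `< m`
  have hmk : AdjoinRoot.mk (X ^ m - C (C (ε ^ m) * X ^ n) : Polynomial (Polynomial k)) g = AdjoinRoot.mk (X ^ m - C (C (ε ^ m) * X ^ n) : Polynomial (Polynomial k)) (g %ₘ (X ^ m - C (C (ε ^ m) * X ^ n) : Polynomial (Polynomial k))) := by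
    rw [eq_comm, AdjoinRoot.mk_eq_mk]
    refine ⟨-(g /ₘ (X ^ m - C (C (ε ^ m) * X ^ n) : Polynomial (Polynomial k))), ?_⟩
    have := Polynomial.modByMonic_add_div g (X ^ m - C (C (ε ^ m) * X ^ n) : Polynomial (Polynomial k))
    linear_combination this
  have hfd : (X ^ m - C (C (ε ^ m) * X ^ n) : Polynomial (Polynomial k)).natDegree = m := by
    rw [Polynomial.natDegree_X_pow_sub_C]
  have hdeg : (g %ₘ (X ^ m - C (C (ε ^ m) * X ^ n) : Polynomial (Polynomial k))).natDegree < m := by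
    by_cases h0 : g %ₘ (X ^ m - C (C (ε ^ m) * X ^ n) : Polynomial (Polynomial k)) = 0
    · rw [h0, Polynomial.natDegree_zero]; exact hm
    · have h1 : (X ^ m - C (C (ε ^ m) * X ^ n) : Polynomial (Polynomial k)) ≠ 1 := by
        intro h1
        have := congrArg Polynomial.natDegree h1
        rw [hfd, Polynomial.natDegree_one] at this
        omega
      have := Polynomial.natDegree_modByMonic_lt g hfm h1
      rwa [hfd] at this
  rw [hmk] at hr ⊢
  rw [AdjoinRoot.lift_mk, Polynomial.eval₂_eq_sum_range' _ hdeg] at hr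
  have hsum : (∑ i ∈ Finset.range m, Polynomial.expand k m ((g %ₘ (X ^ m - C (C (ε ^ m) * X ^ n) : Polynomial (Polynomial k))).coeff i) * (C ε * X ^ n) ^ i) = 0 := by
    simpa only [RingHom.coe_coe] using hr
  have hcoeff : ∀ i ∈ Finset.range m, (g %ₘ (X ^ m - C (C (ε ^ m) * X ^ n) : Polynomial (Polynomial k))).coeff i = 0 := fun i₀ hi₀ => Polynomial.ext fun M => by
    have h := coeff_sum_expand k ε m n hmn hm (fun i => (g %ₘ (X ^ m - C (C (ε ^ m) * X ^ n) : Polynomial (Polynomial k))).coeff i) M (Finset.mem_range.mp hi₀)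
    rw [hsum, Polynomial.coeff_zero] at h
    have h1 : ε ^ i₀ ≠ 0 := pow_ne_zero _ hε
    simpa [h1] using h.symm
  have hg0 : g %ₘ (X ^ m - C (C (ε ^ m) * X ^ n) : Polynomial (Polynomial k)) = 0 := by
    refine Polynomial.ext fun i => ?_
    by_cases hi : i < m
    · rw [hcoeff i (Finset.mem_range.mpr hi), Polynomial.coeff_zero]
    · rw [Polynomial.coeff_zero]
      exact Polynomial.coeff_eq_zero_of_natDegree_lt (by omega)
  rw [hg0, map_zero]

/-- `R = k[t][z]/(zᵐ − εᵐtⁿ)` is a domain (it embeds in `k[τ]`). [folklore] -/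
theorem isDomain_adjoinRoot (hε : ε ≠ 0) (hmn : Nat.Coprime m n) (hm : 0 < m) : IsDomain (AdjoinRoot (X ^ m - C (C (ε ^ m) * X ^ n) : Polynomial (Polynomial k))) :=
  (lift_injective k ε m n hε hmn hm).isDomain _

/-! ## §3 The image: semigroup support and the conductor `τᶜ k[τ]` -/

/-- **Support lemma**: `(φ r).coeff N = 0` unless `N = m·a + n·b` for some `a, b`. [folklore] -/
theorem coeff_lift_eq_zero (hm : 0 < m) (r : AdjoinRoot (X ^ m - C (C (ε ^ m) * X ^ n) : Polynomial (Polynomial k))) (N : ℕ) (hN : ∀ a b : ℕ, N ≠ m * a + n * b) :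
    (AdjoinRoot.lift ((Polynomial.expand k m : Polynomial k →ₐ[k] Polynomial k) : Polynomial k →+* Polynomial k)
        (C ε * X ^ n) (eval₂_f_eq_zero k ε m n) r).coeff N = 0 := by
  obtain ⟨g, rfl⟩ := AdjoinRoot.mk_surjective r
  rw [lift_mk, Polynomial.sum_def, Polynomial.finsetSum_coeff]
  refine Finset.sum_eq_zero fun j _ => ?_
  rw [mul_pow, ← pow_mul, mul_left_comm, ← Polynomial.C_pow, Polynomial.coeff_C_mul,
    Polynomial.coeff_mul_X_pow', Polynomial.coeff_expand hm]
  split_ifs with h1 h2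
  · exfalso
    obtain ⟨a, ha⟩ := h2
    exact hN a j (by rw [← ha]; omega)
  · rw [mul_zero]
  · rw [mul_zero]

/-- **Image lemma**: `τ^{(m−1)(n−1)}·d ∈ φ(R)` for every `d` (`MonomialCusp.exists_param_eq_X_pow_mul` through `R`). [folklore] -/
theorem exists_lift_eq_X_pow_mul (hε : ε ≠ 0) (hmn : Nat.Coprime m n) (hm : 1 < m) (hn : 1 < n) (d : Polynomial k) :
    ∃ r : AdjoinRoot (X ^ m - C (C (ε ^ m) * X ^ n) : Polynomial (Polynomial k)), AdjoinRoot.lift ((Polynomial.expand k m : Polynomial k →ₐ[k] Polynomial k) : Polynomial k →+* Polynomial k)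
        (C ε * X ^ n) (eval₂_f_eq_zero k ε m n) r = X ^ ((m - 1) * (n - 1)) * d := by
  obtain ⟨g, hg⟩ := exists_param_eq_X_pow_mul k ε m n hε hmn hm hn d
  exact ⟨MvPolynomial.aeval (R := k) (![AdjoinRoot.root (X ^ m - C (C (ε ^ m) * X ^ n) : Polynomial (Polynomial k)), AdjoinRoot.of (X ^ m - C (C (ε ^ m) * X ^ n) : Polynomial (Polynomial k)) X] : Fin 2 → AdjoinRoot (X ^ m - C (C (ε ^ m) * X ^ n) : Polynomial (Polynomial k))) g,
    by rw [lift_aeval, hg]⟩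

/-- `mn − m − n` is NOT in the semigroup `⟨m, n⟩` (Sylvester; Mathlib `frobeniusNumber_pair`). [folklore] -/
theorem frobenius_ne (hmn : Nat.Coprime m n) (hm : 1 < m) (hn : 1 < n) (a b : ℕ) : m * n - m - n ≠ m * a + n * b := by
  intro h
  have hF := (frobeniusNumber_pair hmn hm hn).1
  simp only [Set.mem_setOf_eq] at hF
  apply hF
  rw [AddSubmonoid.mem_closure_pair]
  exact ⟨a, b, by rw [smul_eq_mul, smul_eq_mul, h]; ring⟩

/-- Conductor arithmetic: `(m−1)(n−1) − 1 − d + d = mn − m − n` for `d < (m−1)(n−1)`, `m, n ≥ 2`. [folklore] -/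
theorem frobenius_eq_add {d : ℕ} (hm : 1 < m) (hn : 1 < n) (hd : d < (m - 1) * (n - 1)) :
    m * n - m - n = d + ((m - 1) * (n - 1) - 1 - d) := by
  obtain ⟨m'', rfl⟩ : ∃ m'', m = m'' + 2 := ⟨m - 2, by omega⟩
  obtain ⟨n'', rfl⟩ : ∃ n'', n = n'' + 2 := ⟨n - 2, by omega⟩
  have e1 : (m'' + 2) * (n'' + 2) = m'' * n'' + 2 * m'' + 2 * n'' + 4 := by ring
  have e2 : (m'' + 2 - 1) * (n'' + 2 - 1) = m'' * n'' + m'' + n'' + 1 := by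
    rw [show m'' + 2 - 1 = m'' + 1 by omega, show n'' + 2 - 1 = n'' + 1 by omega]; ring
  rw [e2] at hd
  rw [e1, e2]
  omega

/-- **The conductor of `R` in `k[τ]` is `{r | τ^{(m−1)(n−1)} ∣ φ r}`**: `φ(r)·k[τ] ⊆ φ(R)` iff `τᶜ ∣ φ r`. [folklore] -/
theorem forall_exists_iff_X_pow_dvd (hε : ε ≠ 0) (hmn : Nat.Coprime m n) (hm : 1 < m) (hn : 1 < n)
    (r : AdjoinRoot (X ^ m - C (C (ε ^ m) * X ^ n) : Polynomial (Polynomial k))) :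
    (∀ d : Polynomial k, ∃ r' : AdjoinRoot (X ^ m - C (C (ε ^ m) * X ^ n) : Polynomial (Polynomial k)), AdjoinRoot.lift ((Polynomial.expand k m : Polynomial k →ₐ[k] Polynomial k) : Polynomial k →+* Polynomial k)
        (C ε * X ^ n) (eval₂_f_eq_zero k ε m n) r' = AdjoinRoot.lift ((Polynomial.expand k m : Polynomial k →ₐ[k] Polynomial k) : Polynomial k →+* Polynomial k)
        (C ε * X ^ n) (eval₂_f_eq_zero k ε m n) r * d) ↔ X ^ ((m - 1) * (n - 1)) ∣ AdjoinRoot.lift ((Polynomial.expand k m : Polynomial k →ₐ[k] Polynomial k) : Polynomial k →+* Polynomial k)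
        (C ε * X ^ n) (eval₂_f_eq_zero k ε m n) r := by
  constructor
  · intro h
    rw [Polynomial.X_pow_dvd_iff]
    intro d hd
    by_contra hne
    -- `φ r · τ^{c−1−d} ∈ φ(R)` has the coefficient `(φ r)_d ≠ 0` in the forbidden degree `c − 1 = mn − m − n`
    obtain ⟨r', hr'⟩ := h (X ^ ((m - 1) * (n - 1) - 1 - d))
    have hcoeff : (AdjoinRoot.lift ((Polynomial.expand k m : Polynomial k →ₐ[k] Polynomial k) : Polynomial k →+* Polynomial k)
        (C ε * X ^ n) (eval₂_f_eq_zero k ε m n) r').coeff (m * n - m - n) = (AdjoinRoot.lift ((Polynomial.expand k m : Polynomial k →ₐ[k] Polynomial k) : Polynomial k →+* Polynomial k)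
        (C ε * X ^ n) (eval₂_f_eq_zero k ε m n) r).coeff d := by
      rw [hr', frobenius_eq_add m n hm hn hd, Polynomial.coeff_mul_X_pow]
    have hzero : (AdjoinRoot.lift ((Polynomial.expand k m : Polynomial k →ₐ[k] Polynomial k) : Polynomial k →+* Polynomial k)
        (C ε * X ^ n) (eval₂_f_eq_zero k ε m n) r').coeff (m * n - m - n) = 0 :=
      coeff_lift_eq_zero k ε m n (by omega) r' _ (frobenius_ne m n hmn hm hn)
    exact hne (hcoeff ▸ hzero)
  · rintro ⟨e, he⟩ d
    obtain ⟨r', hr'⟩ := exists_lift_eq_X_pow_mul k ε m n hε hmn hm hn (e * d)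
    exact ⟨r', by rw [hr', he, mul_assoc]⟩

/-! ## §4 Finiteness of `k[τ]` over `R`, saturation, and the exact formula -/

/-- `k[τ]` is module-finite over `R` along `φ`: `k[τ] = Σ_{j<m} φ(R)·τʲ` (`τ^{mq+j} = φ(t̄^q)·τʲ`). [folklore] -/
theorem finite_polynomial (hm : 0 < m) :
    letI := (AdjoinRoot.lift ((Polynomial.expand k m : Polynomial k →ₐ[k] Polynomial k) : Polynomial k →+* Polynomial k)
        (C ε * X ^ n) (eval₂_f_eq_zero k ε m n)).toAlgebra
    Module.Finite (AdjoinRoot (X ^ m - C (C (ε ^ m) * X ^ n) : Polynomial (Polynomial k))) (Polynomial k) := by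
  letI := (AdjoinRoot.lift ((Polynomial.expand k m : Polynomial k →ₐ[k] Polynomial k) : Polynomial k →+* Polynomial k)
        (C ε * X ^ n) (eval₂_f_eq_zero k ε m n)).toAlgebra
  classical
  refine ⟨⟨(Finset.range m).image (fun j => (X : Polynomial k) ^ j), ?_⟩⟩
  rw [Finset.coe_image, Finset.coe_range, eq_top_iff]
  rintro d -
  induction d using Polynomial.induction_on' with
  | add p q hp hq => exact Submodule.add_mem _ hp hq
  | monomial N a =>
    have hN : N = m * (N / m) + N % m := (Nat.div_add_mod N m).symm
    have hmem : (X : Polynomial k) ^ (N % m) ∈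
        Submodule.span (AdjoinRoot (X ^ m - C (C (ε ^ m) * X ^ n) : Polynomial (Polynomial k))) ((fun j => (X : Polynomial k) ^ j) '' Set.Iio m) :=
      Submodule.subset_span ⟨N % m, Nat.mod_lt N hm, rfl⟩
    have hsmul := Submodule.smul_mem _ (AdjoinRoot.of (X ^ m - C (C (ε ^ m) * X ^ n) : Polynomial (Polynomial k)) (C a * X ^ (N / m))) hmem
    have heq : (AdjoinRoot.of (X ^ m - C (C (ε ^ m) * X ^ n) : Polynomial (Polynomial k)) (C a * X ^ (N / m))) • (X : Polynomial k) ^ (N % m) = Polynomial.monomial N a := by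
      rw [Algebra.smul_def, RingHom.algebraMap_toAlgebra, lift_of, map_mul (Polynomial.expand k m : _ →ₐ[k] _),
        map_pow (Polynomial.expand k m : _ →ₐ[k] _), Polynomial.expand_C, Polynomial.expand_X, ← pow_mul, mul_assoc,
        ← pow_add, ← hN, Polynomial.C_mul_X_pow_eq_monomial]
    rwa [heq] at hsmul

/-- `k[t]` is regular of Krull dimension `1`, so `ca(R) = ca²(R)` for the hypersurface `R` over it. [folklore] -/
theorem cohomologyAnnihilator_eq_cohomologyAnnihilatorOfDegree_two (hm : 0 < m) :
    cohomologyAnnihilator (AdjoinRoot (X ^ m - C (C (ε ^ m) * X ^ n) : Polynomial (Polynomial k))) = cohomologyAnnihilatorOfDegree (AdjoinRoot (X ^ m - C (C (ε ^ m) * X ^ n) : Polynomial (Polynomial k))) 2 := by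
  have hd : ringKrullDim (Polynomial k) ≤ (1 : ℕ) := by
    rw [Polynomial.ringKrullDim_of_isNoetherianRing, ringKrullDim_eq_zero_of_field, zero_add]
    exact le_of_eq (by norm_cast)
  exact cohomologyAnnihilator_adjoinRoot_eq_of_isRegularRing (d := 1) hd (monic_f k ε m n hm)

/-- **THE EXACT FORMULA**: for `ε ≠ 0` and coprime `m, n > 1`,
`r ∈ ca(k[t][z]/(zᵐ − εᵐtⁿ)) ↔ τ^{(m−1)(n−1)} ∣ φ(r)` — the cohomology annihilator of the monomial branch is its
conductor, at every level. [folklore] -/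
theorem mem_cohomologyAnnihilator_iff_X_pow_dvd (hε : ε ≠ 0) (hmn : Nat.Coprime m n) (hm : 1 < m) (hn : 1 < n)
    (r : AdjoinRoot (X ^ m - C (C (ε ^ m) * X ^ n) : Polynomial (Polynomial k))) :
    r ∈ cohomologyAnnihilator (AdjoinRoot (X ^ m - C (C (ε ^ m) * X ^ n) : Polynomial (Polynomial k))) ↔ X ^ ((m - 1) * (n - 1)) ∣ AdjoinRoot.lift ((Polynomial.expand k m : Polynomial k →ₐ[k] Polynomial k) : Polynomial k →+* Polynomial k)
        (C ε * X ^ n) (eval₂_f_eq_zero k ε m n) r := by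
  have hinj : Function.Injective (AdjoinRoot.lift ((Polynomial.expand k m : Polynomial k →ₐ[k] Polynomial k) : Polynomial k →+* Polynomial k)
        (C ε * X ^ n) (eval₂_f_eq_zero k ε m n)) := lift_injective k ε m n hε hmn (by omega)
  rw [← forall_exists_iff_X_pow_dvd k ε m n hε hmn hm hn r]
  constructor
  · -- ceiling: saturation `ca = ca² ⊆ ca³`, then the ring-map ceiling with `c₀ = t̄^{n−1}`
    intro hr d
    letI := (AdjoinRoot.lift ((Polynomial.expand k m : Polynomial k →ₐ[k] Polynomial k) : Polynomial k →+* Polynomial k)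
        (C ε * X ^ n) (eval₂_f_eq_zero k ε m n)).toAlgebra
    have hA : ∀ x : AdjoinRoot (X ^ m - C (C (ε ^ m) * X ^ n) : Polynomial (Polynomial k)), algebraMap (AdjoinRoot (X ^ m - C (C (ε ^ m) * X ^ n) : Polynomial (Polynomial k))) (Polynomial k) x = AdjoinRoot.lift ((Polynomial.expand k m : Polynomial k →ₐ[k] Polynomial k) : Polynomial k →+* Polynomial k)
        (C ε * X ^ n) (eval₂_f_eq_zero k ε m n) x := fun x => rfl
    haveI := finite_polynomial k ε m n (by omega)
    haveI : IsDomain (AdjoinRoot (X ^ m - C (C (ε ^ m) * X ^ n) : Polynomial (Polynomial k))) := isDomain_adjoinRoot k ε m n hε hmn (by omega)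
    have hc₀ : ∀ γ : Polynomial k, ∃ b : AdjoinRoot (X ^ m - C (C (ε ^ m) * X ^ n) : Polynomial (Polynomial k)), algebraMap (AdjoinRoot (X ^ m - C (C (ε ^ m) * X ^ n) : Polynomial (Polynomial k))) (Polynomial k) b =
        algebraMap (AdjoinRoot (X ^ m - C (C (ε ^ m) * X ^ n) : Polynomial (Polynomial k))) (Polynomial k) (AdjoinRoot.of (X ^ m - C (C (ε ^ m) * X ^ n) : Polynomial (Polynomial k)) (X ^ (n - 1))) * γ := fun γ => by
      obtain ⟨r', hr'⟩ := exists_lift_eq_X_pow_mul k ε m n hε hmn hm hn (X ^ (n - 1) * γ)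
      refine ⟨r', ?_⟩
      rw [hA, hA, hr', lift_of_X_pow, ← mul_assoc, ← pow_add]
      congr 2
      obtain ⟨m'', rfl⟩ : ∃ m'', m = m'' + 2 := ⟨m - 2, by omega⟩
      obtain ⟨n'', rfl⟩ : ∃ n'', n = n'' + 2 := ⟨n - 2, by omega⟩
      rw [show m'' + 2 - 1 = m'' + 1 by omega, show n'' + 2 - 1 = n'' + 1 by omega]
      ring
    have hc₀0 : algebraMap (AdjoinRoot (X ^ m - C (C (ε ^ m) * X ^ n) : Polynomial (Polynomial k))) (Polynomial k) (AdjoinRoot.of (X ^ m - C (C (ε ^ m) * X ^ n) : Polynomial (Polynomial k)) (X ^ (n - 1))) ≠ 0 := by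
      rw [hA, lift_of_X_pow]
      exact pow_ne_zero _ Polynomial.X_ne_zero
    have hr3 : r ∈ cohomologyAnnihilatorOfDegree (AdjoinRoot (X ^ m - C (C (ε ^ m) * X ^ n) : Polynomial (Polynomial k))) 3 := by
      rw [cohomologyAnnihilator_eq_cohomologyAnnihilatorOfDegree_two k ε m n (by omega)] at hr
      exact cohomologyAnnihilatorOfDegree_mono (by norm_num) hr
    obtain ⟨b, hb⟩ := exists_eq_mul_of_mem_cohomologyAnnihilatorOfDegree_three hinj hc₀ hc₀0 hr3 d
    exact ⟨b, by rw [← hA, ← hA, hb]⟩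
  · -- floor: the PID conductor floor
    intro h
    exact cohomologyAnnihilatorOfDegree_le 2 (mem_cohomologyAnnihilatorOfDegree_two_of_conductor_ringHom _ hinj h)

/-- Levelled: `r ∈ caᴺ(R) ↔ τ^{(m−1)(n−1)} ∣ φ(r)` for every `N ≥ 2`. [folklore] -/
theorem mem_cohomologyAnnihilatorOfDegree_iff_X_pow_dvd (hε : ε ≠ 0) (hmn : Nat.Coprime m n) (hm : 1 < m)
    (hn : 1 < n) {N : ℕ} (hN : 2 ≤ N) (r : AdjoinRoot (X ^ m - C (C (ε ^ m) * X ^ n) : Polynomial (Polynomial k))) :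
    r ∈ cohomologyAnnihilatorOfDegree (AdjoinRoot (X ^ m - C (C (ε ^ m) * X ^ n) : Polynomial (Polynomial k))) N ↔ X ^ ((m - 1) * (n - 1)) ∣ AdjoinRoot.lift ((Polynomial.expand k m : Polynomial k →ₐ[k] Polynomial k) : Polynomial k →+* Polynomial k)
        (C ε * X ^ n) (eval₂_f_eq_zero k ε m n) r := by
  constructor
  · intro hr
    exact (mem_cohomologyAnnihilator_iff_X_pow_dvd k ε m n hε hmn hm hn r).mp (cohomologyAnnihilatorOfDegree_le N hr)
  · intro h
    exact cohomologyAnnihilatorOfDegree_mono hN (mem_cohomologyAnnihilatorOfDegree_two_of_conductor_ringHom _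
      (lift_injective k ε m n hε hmn (by omega)) ((forall_exists_iff_X_pow_dvd k ε m n hε hmn hm hn r).mpr h))

/-- `φ(z̄ᵇ t̄ᵃ) = εᵇ τ^{nb+ma}`. [folklore] -/
theorem lift_root_pow_mul_of_X_pow (a b : ℕ) :
    AdjoinRoot.lift ((Polynomial.expand k m : Polynomial k →ₐ[k] Polynomial k) : Polynomial k →+* Polynomial k)
        (C ε * X ^ n) (eval₂_f_eq_zero k ε m n) (AdjoinRoot.root (X ^ m - C (C (ε ^ m) * X ^ n) : Polynomial (Polynomial k)) ^ b * AdjoinRoot.of (X ^ m - C (C (ε ^ m) * X ^ n) : Polynomial (Polynomial k)) X ^ a) = C (ε ^ b) * X ^ (n * b + m * a) := by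
  rw [map_mul (AdjoinRoot.lift ((Polynomial.expand k m : Polynomial k →ₐ[k] Polynomial k) : Polynomial k →+* Polynomial k)
        (C ε * X ^ n) (eval₂_f_eq_zero k ε m n)), map_pow (AdjoinRoot.lift ((Polynomial.expand k m : Polynomial k →ₐ[k] Polynomial k) : Polynomial k →+* Polynomial k)
        (C ε * X ^ n) (eval₂_f_eq_zero k ε m n)), ← map_pow (AdjoinRoot.of (X ^ m - C (C (ε ^ m) * X ^ n) : Polynomial (Polynomial k))), lift_root, lift_of_X_pow, mul_pow,
    ← Polynomial.C_pow, ← pow_mul, mul_assoc, ← pow_add]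

/-- **MONOMIALS**: `z̄ᵇ t̄ᵃ ∈ ca(k[t][z]/(zᵐ − εᵐtⁿ)) ↔ (m−1)(n−1) ≤ nb + ma`. [folklore] -/
theorem root_pow_mul_of_X_pow_mem_cohomologyAnnihilator_iff (hε : ε ≠ 0) (hmn : Nat.Coprime m n) (hm : 1 < m)
    (hn : 1 < n) (a b : ℕ) :
    AdjoinRoot.root (X ^ m - C (C (ε ^ m) * X ^ n) : Polynomial (Polynomial k)) ^ b * AdjoinRoot.of (X ^ m - C (C (ε ^ m) * X ^ n) : Polynomial (Polynomial k)) X ^ a ∈ cohomologyAnnihilator (AdjoinRoot (X ^ m - C (C (ε ^ m) * X ^ n) : Polynomial (Polynomial k))) ↔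
      (m - 1) * (n - 1) ≤ n * b + m * a := by
  rw [mem_cohomologyAnnihilator_iff_X_pow_dvd k ε m n hε hmn hm hn, lift_root_pow_mul_of_X_pow,
    Polynomial.X_pow_dvd_iff]
  constructor
  · intro h
    by_contra hlt
    have := h (n * b + m * a) (by omega)
    rw [Polynomial.coeff_C_mul, Polynomial.coeff_X_pow_self, mul_one] at this
    exact pow_ne_zero _ hε this
  · intro h d hd
    rw [Polynomial.coeff_C_mul, Polynomial.coeff_X_pow, if_neg (by omega), mul_zero]

/-- Levelled monomial criterion: `z̄ᵇ t̄ᵃ ∈ caᴺ(R) ↔ (m−1)(n−1) ≤ nb + ma` for every `N ≥ 2`. [folklore] -/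
theorem root_pow_mul_of_X_pow_mem_cohomologyAnnihilatorOfDegree_iff (hε : ε ≠ 0) (hmn : Nat.Coprime m n)
    (hm : 1 < m) (hn : 1 < n) {N : ℕ} (hN : 2 ≤ N) (a b : ℕ) :
    AdjoinRoot.root (X ^ m - C (C (ε ^ m) * X ^ n) : Polynomial (Polynomial k)) ^ b * AdjoinRoot.of (X ^ m - C (C (ε ^ m) * X ^ n) : Polynomial (Polynomial k)) X ^ a ∈ cohomologyAnnihilatorOfDegree (AdjoinRoot (X ^ m - C (C (ε ^ m) * X ^ n) : Polynomial (Polynomial k))) N ↔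
      (m - 1) * (n - 1) ≤ n * b + m * a := by
  rw [mem_cohomologyAnnihilatorOfDegree_iff_X_pow_dvd k ε m n hε hmn hm hn hN,
    ← mem_cohomologyAnnihilator_iff_X_pow_dvd k ε m n hε hmn hm hn]
  exact root_pow_mul_of_X_pow_mem_cohomologyAnnihilator_iff k ε m n hε hmn hm hn a b

end Summit.ResolutionOfSingularities.ResolutionOfSingularities.Theorems.HomologicalConductor.MonomialCurveExact

end
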